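import Mathlib
import Literature.Analysis.FluidPDE.SuitableWeak
import Literature.Analysis.FluidPDE.ClassicalSolutionGlue
import Summits.NavierStokesRegularity.NavierStokesRegularity.Theorems.EulerZoomLiouvillePowerGaugeEulerLiouvilleSmallTypeIGradientEventually
import Summits.NavierStokesRegularity.NavierStokesRegularity.Theorems.EulerZoomLiouvillePowerGaugeEulerLiouvilleSubunitVortexStretching
import Summits.NavierStokesRegularity.NavierStokesRegularity.Theorems.EulerZoomLiouvillePowerGaugeEulerLiouvillePastIrrotational
import HarnessLib

/-!
# Crux E `PowerGaugeEulerLiouville` (stmt-NavierStokesRegularity-19832): Type-I classical PASTS that were small-Type-I / sub-unit-stretching are trivial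

Route `EulerZoomLiouville` (NavierStokesRegularity), crux E = Seregin's power-gauged ancient-Euler Liouville
statement.  ns-typeII-p1 g8's vorticity-tame strata `KelvinPhysical.ae_eq_zero_of_gauge_of_eventually_smallTypeI`
(Chae 2010 Thm 1.1, ancient form) and `KelvinPhysical.ae_eq_zero_of_gauge_of_subunitVortexStretching` assume the
member is a CLASSICAL Euler solution on the WHOLE open past `(−∞, 0)` with a Type-I gradient bound there.  Here
the classical structure and the Type-I bound `‖∇u(τ)‖ ≤ K'/(−τ)` are assumed only on a past sub-slab `(−∞, T₁)`,
`T₁ ≤ 0` — the member may develop a FIRST SINGULARITY at the interior time `T₁ < 0` and continue as ANY suitable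
weak flow on `[T₁, 0)` — together with, in the far past, EITHER a small Type-I constant `K < 1`
(`PastKelvin.ae_eq_zero_of_gauge_of_pastEventuallySmallTypeI`) OR a sub-unit vortex-stretching rate
`⟪∇u ω, ω⟫ ≤ K‖ω‖²/(−τ)`, `K < 1` (`PastKelvin.ae_eq_zero_of_gauge_of_pastSubunitVortexStretching`); the member
is trivial.  Proof: time-translate the classical past to `(−∞, 0)` (`IsClassicalNSSolutionOn.comp_add_right`;
the Type-I bounds only improve, `K/(−(s+T₁)) ≤ K/(−s)`), apply p1 g8's pointwise conclusions
`KelvinPhysical.curl_eq_zero_of_eventually_smallTypeI` / `…curl_eq_zero_of_subunitVortexStretching` (every slice of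
the translated flow is irrotational), and finish with the lead's irrotational-incompressible-`C²`-PAST stratum
`PastIrrotational.ae_eq_zero_of_gauge_of_pastIrrotational` (harmonic slices + `A`-gauge growth + quiescent past).
WHAT THIS IS NOT: not NS regularity, not the crux `E` — past forms of two classical strata (interim LEAD ns-typeII-p2 g9).
-/

noncomputable section

set_option linter.dupNamespace false

open MeasureTheory Set Filter Topology Metric Function TopologicalSpace
open scoped ENNReal NNReal RealInnerProductSpace

namespace Summit.NavierStokesRegularity.NavierStokesRegularity.Theorems.PowerGaugeEulerLiouville.PastKelvin

open Literature.Analysis Literature.Analysis.FunctionSpaces Literature.Analysis.FluidPDE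

/-- **Time translation of a classical Euler past to the standard past.**  If `(u, p)` is a classical Euler
solution on `(−∞, T₁)` then `s ↦ (u(s + T₁), p(s + T₁))` is one on `(−∞, 0)`. [folklore] -/
theorem isClassicalEuler_translate {u : ℝ → EuclideanSpace ℝ (Fin 3) → EuclideanSpace ℝ (Fin 3)}
    {p : ℝ → EuclideanSpace ℝ (Fin 3) → ℝ} {T₁ : ℝ} (hcl : IsClassicalEulerSolutionOn (Iio T₁) 0 u p) :
    IsClassicalEulerSolutionOn (Iio 0) 0 (fun s => u (s + T₁)) (fun s => p (s + T₁)) := by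
  have h := hcl.comp_add_right T₁
  have hS : ((fun s : ℝ => s + T₁) ⁻¹' Iio T₁ : Set ℝ) = Iio 0 := by
    ext s
    simp
  rw [hS] at h
  exact h

/-- **A Type-I gradient bound only improves under translation to the standard past**: for `σ < 0`, `T₁ ≤ 0` and
`K ≥ 0`, `K/(−(σ + T₁)) ≤ K/(−σ)`. [folklore] -/
theorem typeI_bound_translate {K T₁ σ : ℝ} (hK : 0 ≤ K) (hT₁ : T₁ ≤ 0) (hσ : σ < 0) :
    K / (-(σ + T₁)) ≤ K / (-σ) :=
  div_le_div_of_nonneg_left hK (by linarith) (by linarith)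

/-- **Classical Type-I PASTS that were small-Type-I in the far past are trivial.**  Crux hypotheses verbatim
(`0 < ρ ≤ ½`) + `(u, p)` classical Euler on `(−∞, T₁)` (`T₁ ≤ 0`; nothing assumed on `[T₁, 0)`) +
`‖∇u(τ, x)‖ ≤ K'/(−τ)` for `τ < T₁` + `‖∇u(τ, x)‖ ≤ K/(−τ)` for `τ < T₀` with `K < 1` ⇒ `u = 0` a.e. on the slab.
The whole-past case `T₁ = 0` is ns-typeII-p1 g8's `KelvinPhysical.ae_eq_zero_of_gauge_of_eventually_smallTypeI`. [folklore] -/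
theorem ae_eq_zero_of_gauge_of_pastEventuallySmallTypeI {ρ : ℝ} (hρ : 0 < ρ) (hρ3 : ρ ≤ 1 / 2)
    {u : ℝ → EuclideanSpace ℝ (Fin 3) → EuclideanSpace ℝ (Fin 3)} {p : ℝ → EuclideanSpace ℝ (Fin 3) → ℝ}
    {H : ℝ → EuclideanSpace ℝ (Fin 3) → EuclideanSpace ℝ (Fin 3) →L[ℝ] EuclideanSpace ℝ (Fin 3)} {c : ℝ≥0}
    (hsw : IsSuitableWeakSolutionOn (slab (EuclideanSpace ℝ (Fin 3)) (Iio 0) isOpen_Iio) 0 0 u p)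
    (hH : HasWeakSpatialGradientOn (slab (EuclideanSpace ℝ (Fin 3)) (Iio 0) isOpen_Iio) u H)
    (hc : ∀ a : ℝ, 0 < a → ENNReal.ofReal (a ^ (2 * ρ)) * cknA a (0 : ℝ × EuclideanSpace ℝ (Fin 3)) u +
        ENNReal.ofReal (a ^ ρ) * cknE a (0 : ℝ × EuclideanSpace ℝ (Fin 3)) H +
        ENNReal.ofReal (a ^ (2 * ρ)) * cknD a (0 : ℝ × EuclideanSpace ℝ (Fin 3)) p ≤ (c : ℝ≥0∞))
    {T₁ : ℝ} (hT₁ : T₁ ≤ 0) (hcl : IsClassicalEulerSolutionOn (Iio T₁) 0 u p)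
    {K' : ℝ} (hK' : ∀ τ : ℝ, τ < T₁ → ∀ x, ‖fderiv ℝ (u τ) x‖ ≤ K' / (-τ))
    {K T₀ : ℝ} (hK1 : K < 1) (hK : ∀ τ : ℝ, τ < T₀ → ∀ x, ‖fderiv ℝ (u τ) x‖ ≤ K / (-τ)) :
    uncurry u =ᵐ[volume.restrict (Iio (0 : ℝ) ×ˢ (univ : Set (EuclideanSpace ℝ (Fin 3))))] 0 := by
  have hcl' := isClassicalEuler_translate hcl
  -- signs of the constants
  have hK'0 : 0 ≤ K' := by
    have h := hK' (T₁ - 1) (by linarith) 0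
    by_contra hneg
    push Not at hneg
    have : K' / (-(T₁ - 1)) < 0 := div_neg_of_neg_of_pos hneg (by linarith)
    linarith [norm_nonneg (fderiv ℝ (u (T₁ - 1)) 0)]
  have hK0 : 0 ≤ K := by
    have h := hK (min T₀ 0 - 1) (by have := min_le_left T₀ 0; linarith) 0
    by_contra hneg
    push Not at hneg
    have hpos : 0 < -(min T₀ 0 - 1) := by have := min_le_right T₀ 0; linarith
    have : K / (-(min T₀ 0 - 1)) < 0 := div_neg_of_neg_of_pos hneg hpos
    linarith [norm_nonneg (fderiv ℝ (u (min T₀ 0 - 1)) 0)]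
  -- the translated bounds
  have hK'' : ∀ σ : ℝ, σ < 0 → ∀ x, ‖fderiv ℝ ((fun s => u (s + T₁)) σ) x‖ ≤ K' / (-σ) := by
    intro σ hσ x
    exact (hK' (σ + T₁) (by linarith) x).trans (typeI_bound_translate hK'0 hT₁ hσ)
  set T₀' : ℝ := min (T₀ - T₁) (-1) with hT₀'
  have hT₀'0 : T₀' < 0 := lt_of_le_of_lt (min_le_right _ _) (by norm_num)
  have hK''2 : ∀ σ : ℝ, σ < T₀' → ∀ x, ‖fderiv ℝ ((fun s => u (s + T₁)) σ) x‖ ≤ K / (-σ) := by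
    intro σ hσ x
    have h1 : σ + T₁ < T₀ := by have := min_le_left (T₀ - T₁) (-1); linarith
    have hσ0 : σ < 0 := hσ.trans hT₀'0
    exact (hK (σ + T₁) h1 x).trans (typeI_bound_translate hK0 hT₁ hσ0)
  -- every slice before `T₁` is irrotational
  have hcurl : ∀ τ : ℝ, τ < T₁ → ∀ x, curl (u τ) x = 0 := by
    intro τ hτ x
    have hs : τ - T₁ < 0 := by linarith
    have h := KelvinPhysical.curl_eq_zero_of_eventually_smallTypeI hcl' hK'' hT₀'0 hK1 hK''2 hs x
    simpa using h
  -- the irrotational incompressible `C²` past stratum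
  exact PastIrrotational.ae_eq_zero_of_gauge_of_pastIrrotational hρ hρ3 hsw hH hc hT₁
    (fun τ hτ => (hcl.contDiff_velocity hτ).of_le (by norm_cast))
    (fun τ hτ => hcl.divFree τ hτ) hcurl

/-- **Classical Type-I PASTS with a sub-unit vortex-stretching rate are trivial.**  Crux hypotheses verbatim
(`0 < ρ ≤ ½`) + `(u, p)` classical Euler on `(−∞, T₁)` (`T₁ ≤ 0`) + `‖∇u(τ, x)‖ ≤ K'/(−τ)` and
`⟪∇u(τ,x) ω(τ,x), ω(τ,x)⟫ ≤ K‖ω(τ,x)‖²/(−τ)` for `τ < T₁`, `K < 1` ⇒ `u = 0` a.e. on the slab.  The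
whole-past case `T₁ = 0` is ns-typeII-p1 g8's `KelvinPhysical.ae_eq_zero_of_gauge_of_subunitVortexStretching`. [folklore] -/
theorem ae_eq_zero_of_gauge_of_pastSubunitVortexStretching {ρ : ℝ} (hρ : 0 < ρ) (hρ3 : ρ ≤ 1 / 2)
    {u : ℝ → EuclideanSpace ℝ (Fin 3) → EuclideanSpace ℝ (Fin 3)} {p : ℝ → EuclideanSpace ℝ (Fin 3) → ℝ}
    {H : ℝ → EuclideanSpace ℝ (Fin 3) → EuclideanSpace ℝ (Fin 3) →L[ℝ] EuclideanSpace ℝ (Fin 3)} {c : ℝ≥0}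
    (hsw : IsSuitableWeakSolutionOn (slab (EuclideanSpace ℝ (Fin 3)) (Iio 0) isOpen_Iio) 0 0 u p)
    (hH : HasWeakSpatialGradientOn (slab (EuclideanSpace ℝ (Fin 3)) (Iio 0) isOpen_Iio) u H)
    (hc : ∀ a : ℝ, 0 < a → ENNReal.ofReal (a ^ (2 * ρ)) * cknA a (0 : ℝ × EuclideanSpace ℝ (Fin 3)) u +
        ENNReal.ofReal (a ^ ρ) * cknE a (0 : ℝ × EuclideanSpace ℝ (Fin 3)) H +
        ENNReal.ofReal (a ^ (2 * ρ)) * cknD a (0 : ℝ × EuclideanSpace ℝ (Fin 3)) p ≤ (c : ℝ≥0∞))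
    {T₁ : ℝ} (hT₁ : T₁ ≤ 0) (hcl : IsClassicalEulerSolutionOn (Iio T₁) 0 u p)
    {K' : ℝ} (hK' : ∀ τ : ℝ, τ < T₁ → ∀ x, ‖fderiv ℝ (u τ) x‖ ≤ K' / (-τ))
    {K : ℝ} (hK1 : K < 1)
    (hS : ∀ τ : ℝ, τ < T₁ → ∀ x : EuclideanSpace ℝ (Fin 3),
      ⟪fderiv ℝ (u τ) x (curl (u τ) x), curl (u τ) x⟫ ≤ K / (-τ) * ‖curl (u τ) x‖ ^ 2) :
    uncurry u =ᵐ[volume.restrict (Iio (0 : ℝ) ×ˢ (univ : Set (EuclideanSpace ℝ (Fin 3))))] 0 := by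
  have hcl' := isClassicalEuler_translate hcl
  have hK'0 : 0 ≤ K' := by
    have h := hK' (T₁ - 1) (by linarith) 0
    by_contra hneg
    push Not at hneg
    have : K' / (-(T₁ - 1)) < 0 := div_neg_of_neg_of_pos hneg (by linarith)
    linarith [norm_nonneg (fderiv ℝ (u (T₁ - 1)) 0)]
  have hK'' : ∀ σ : ℝ, σ < 0 → ∀ x, ‖fderiv ℝ ((fun s => u (s + T₁)) σ) x‖ ≤ K' / (-σ) := by
    intro σ hσ x
    exact (hK' (σ + T₁) (by linarith) x).trans (typeI_bound_translate hK'0 hT₁ hσ)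
  -- the stretching rate with the nonnegative constant `max K 0 < 1`
  set Kp : ℝ := max K 0 with hKp
  have hKp1 : Kp < 1 := max_lt hK1 one_pos
  have hKp0 : 0 ≤ Kp := le_max_right _ _
  have hS'' : ∀ σ : ℝ, σ < 0 → ∀ x : EuclideanSpace ℝ (Fin 3),
      ⟪fderiv ℝ ((fun s => u (s + T₁)) σ) x (curl ((fun s => u (s + T₁)) σ) x),
        curl ((fun s => u (s + T₁)) σ) x⟫ ≤ Kp / (-σ) * ‖curl ((fun s => u (s + T₁)) σ) x‖ ^ 2 := by
    intro σ hσ x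
    have h1 := hS (σ + T₁) (by linarith) x
    have hpos : 0 < -(σ + T₁) := by linarith
    have h2 : K / (-(σ + T₁)) ≤ Kp / (-(σ + T₁)) := div_le_div_of_nonneg_right (le_max_left _ _) hpos.le
    have h3 : Kp / (-(σ + T₁)) ≤ Kp / (-σ) := typeI_bound_translate hKp0 hT₁ hσ
    have h4 := norm_nonneg (curl (u (σ + T₁)) x)
    show ⟪fderiv ℝ (u (σ + T₁)) x (curl (u (σ + T₁)) x), curl (u (σ + T₁)) x⟫ ≤
      Kp / (-σ) * ‖curl (u (σ + T₁)) x‖ ^ 2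
    nlinarith
  have hcurl : ∀ τ : ℝ, τ < T₁ → ∀ x, curl (u τ) x = 0 := by
    intro τ hτ x
    have hs : τ - T₁ < 0 := by linarith
    have h := KelvinPhysical.curl_eq_zero_of_subunitVortexStretching hcl' hK'' hKp1 hS'' hs x
    simpa using h
  exact PastIrrotational.ae_eq_zero_of_gauge_of_pastIrrotational hρ hρ3 hsw hH hc hT₁
    (fun τ hτ => (hcl.contDiff_velocity hτ).of_le (by norm_cast))
    (fun τ hτ => hcl.divFree τ hτ) hcurl

end Summit.NavierStokesRegularity.NavierStokesRegularity.Theorems.PowerGaugeEulerLiouville.PastKelvin
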